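import Summits.QuantumFields.YangMills.Theorems.BalabanUVNodesN22W1StripGeneratorTermwise

/-!
# BalabanUVNodes ∕ node N22 = NE9 — THE STRIP INDUCTION AT THE W1 OBJECT, MODULE 21′: THE LAST COUPLING PER TERM — node N09's conditional clause (S-last) from a
# TERM-LEVEL schema (S-last-T) «each (2.14) term, as a function of the COMPLEX LAST COUPLING with real admissible older terms, holomorphic with the (2.26) weight bound
# on a common domain» by Lemma 3's resummation + S25 read for the one-step generator; the N22 leaf with ALL analytic inputs at term level

Cell `pub-ymgap`, HUMAN RULING D-0062 (Track A), R134 ACCELERATION re-seat `pub-ymgap-dag-n22-c` (strategy s1), generation 4, module 21′.  THEOREMS ONLY; imports module 20′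
`…N22W1StripGeneratorTermwise` (transitively 14′ ∕ 16′ ∕ 18′ ∕ 19′, S25 `analytic_and_bounded_locE_param_torus`, the Lemma-3 socket, node00-def-W1 g4's `StepGen`) BY NAME.
`--supports` K3′ (helper).

WHY.  Module 18′ asks node N09's lane for (S-last) at the E-level ((2.13) after the Kotecký–Preiss resummation).  In print the E-level bound (1.18) for the new term comes from the
term-level (2.26) by Lemma 3's resummation ((2.38)) and the S25 transport (2.39)–(2.41) — kernel-checked in the tree and same-domain (module 14′ §2).  Read for the ONE-STEP
GENERATOR in the complex LAST coupling `z`: per-term holomorphy + (2.26) weights on `U` (with the p. 266 analytic option the `|P|`-rate is `g_k`-independent, so a fixed real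
rate `a` is print's) ⟹ `z ↦ (Gn k′).E z old φ X` holomorphic on `U` with `‖·‖ ≤ E₀e^{−κ d_{k′+1}(X)}` — i.e. (S-last).  With module 20′ this makes EVERY analytic input of the N22
leaf a TERM-LEVEL statement: [II] (2.26) per term, complexified in the older terms ((S-226-T), node N10) and in the last coupling ((S-last-T), node N09).

WHAT.
* §1 `stepE_stripOn_of_termwise226` — at one step and one older-terms family: complexified activities `z ↦ (Gn k′).H z old φ Z` holomorphic on an open `U`, dominated termwise
  over print's `terms L M Z` with the (2.26) weights ⟹ `z ↦ (Gn k′).E z old φ X` holomorphic on `U` with (1.18) there (`hRep_of_termwise` + `h238_of_hRep_half` + S25; the one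
  `locE` literal of `StepGen.E`).
* §2 ★ `stepSchemaLast_of_termwise` — (S-last-T)_{k′<K} (per step: ∀ old, ∃ U ⊇ closed r-discs, (1.18)-size of `old` on the spaces → ∀ X φ, ∃ Tt: holomorphy of the activities
  in `z` on `U`, domination, weights) + numerals ⟹ (S-last)_{k′<K}; `stepSchemaLast_of_termwiseIdx` — the same from the PER-TERM form under index maps into print's term set
  (20′ §1's re-indexing).
* §3 ★ `s_N22_readingOfRecord₁₂_ofRecordAdm_runTowers_toClusterTower_of_s_N18_allTermwise` — THE LEAF WITH ALL ANALYTIC INPUTS AT TERM LEVEL: `S_N18` + signs + per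
  `(F, θ, k)` ∃(tuple; index maps `e`; `hspk`; numerals; (S-loc); `e` into `terms` + injective; (S-226-T); (S-last-T) per term) ⟹ `S_N22`.
* §4 `nonempty_admBg_of_spaceTable` — the admissible run-A slot is INHABITED when the run-length-`k` table is the space table of record (unit field; `Sect2.one_mem_spaceI` +
  `AdmBg.nonempty_of_mem`): the clause a COUNT claim at this reading must carry (ref-F READ-173 (α), ref-H READ-50 A1 WATCH), now by name.

HONEST FRAMING.  Count-neutral by-name knit; NOT a discharge of N22: (S-226-T), (S-last-T), (S-loc) are DISPLAYED schemas on an abstract generator, asserted nowhere ([II] (2.26)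
per term with complex parameters — NOT PRINTED as such; print bounds real terms); the identification of `Gn` and of its index sets with NODE 00's generator of record and print's
(𝐃, P) is NODE 00's; `S_N18` is node N18's stub; numerals witnessed ∀ M by 17′ but the reading's; statements at `ofRecordAdm` vacuous where `AdmBg … k = ∅`.  NE9 NOT IN PRINT;
one finite four-torus programme at fixed ε — NOT infinite volume, NOT OS on ℝ⁴, NOT a mass gap, NOT Clay.  0 `sorry`, 0 `def`, standard axioms.

References (TYPES only): [I] = [Balaban1987RG1] §1 p. 263, p. 266 (analytic option), (2.12)–(2.13) p. 268; [II] = [Balaban1988RG2Cluster] (2.9)–(2.15) pp. 14–15, (2.26)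
p. 17, Lemma 3 (2.38) p. 20, (2.39)–(2.41) p. 21.
-/

noncomputable section

open scoped Matrix.Norms.L2Operator

namespace YMDAG.N22.W1

open Set Metric
open scoped BigOperators
open Literature.MathematicalPhysics.QuantumFieldTheory.Balaban1983to89
open Literature.MathematicalPhysics.QuantumFieldTheory.Balaban1983to89.T4Continuum
open Literature.MathematicalPhysics.QuantumFieldTheory.Balaban1983to89.T4OutputRate
open Literature.MathematicalPhysics.QuantumFieldTheory.Balaban1983to89.B13Resummation (locE)
open Literature.MathematicalPhysics.QuantumFieldTheory.Balaban1983to89.TreeLengthTorus (TPt TDom tsys torusTreeLen torusTreeLen_nonneg)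
open Literature.MathematicalPhysics.QuantumFieldTheory.Balaban1983to89.TreeLengthTorusGeometry (TTouch)
open Literature.MathematicalPhysics.QuantumFieldTheory.Balaban1983to89.B12TreeDecay (K₀ K₀_pos)
open Literature.MathematicalPhysics.QuantumFieldTheory.Balaban1983to89.B13Lemma3TorusData (TBond)
open Literature.MathematicalPhysics.QuantumFieldTheory.Balaban1983to89.B13Lemma3Torus (TwoTorusStep)
open Literature.MathematicalPhysics.QuantumFieldTheory.Balaban1983to89.B13Lemma3TorusTerms (terms weight weight_nonneg)
open Literature.MathematicalPhysics.QuantumFieldTheory.Balaban1983to89.B13Lemma3TorusSocket (HRep Lemma3Numerics h238_of_hRep_half hRep_of_termwise)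
open Literature.MathematicalPhysics.QuantumFieldTheory.Balaban1983to89.Step (SFConsts)
open Literature.MathematicalPhysics.QuantumFieldTheory.Balaban1983to89.Node00
  (Stage12Params IsDatumOfRecord₁₂C U3Objects₁₁ U3Letters₁₁ MatA ιSU prependCoupling)
open Literature.MathematicalPhysics.QuantumFieldTheory.Balaban1983to89.Node00.Sect2 (domSys domCount CPair ofBackgroundC spaceI domSites Setting Residual)
open Literature.MathematicalPhysics.QuantumFieldTheory.Balaban1983to89.Node00.W1
open Summit.QuantumFields.BalabanUV.T4Continuum.NE1p.DressedOutputAnalyticFaces (analytic_and_bounded_locE_param_torus)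
open YMDAG.UVSplit

variable {N : ℕ} [NeZero N]

section StepLevel

variable {F : T4Family} (k : ℕ) {𝔸 : Type*} [NormedRing 𝔸] [NormedAlgebra ℂ 𝔸] [CompleteSpace 𝔸] {G : Type*} [GaugeGroup G] {M : ℕ}
  (Sg : Setting 𝔸 G) (Rz : Residual (F.P k) 𝔸)

/-! ## §1 Lemma 3 + S25 for the one-step generator in the complex last coupling, same domain -/

omit [NormedRing 𝔸] [NormedAlgebra ℂ 𝔸] [CompleteSpace 𝔸] in
open Classical in
/-- **THE ONE-STEP MAP IS HOLOMORPHIC IN THE COMPLEX LAST COUPLING WITH (1.18), FROM TERM-LEVEL (2.26) ON A COMMON DOMAIN.**  For a one-step generator `Gk` at step `k′`,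
a fixed older-terms family `old`, a configuration `φ` and a domain `X ∈ 𝐃_{k′+1}`: complexified term values `Tt` over print's `terms L M Z` with `z ↦ Gk.H z old φ Z` holomorphic on
the open `U` for `Z ⊆ X`, `‖Gk.H z old φ Z‖ ≤ Σ_t ‖Tt Z t z‖` and `‖Tt Z t z‖ ≤ weight(t)·e^{a₅|Z|}` on `U` ⟹ `z ↦ Gk.E z old φ X` holomorphic on `U` with `‖·‖ ≤ E₀e^{−κ d(X)}` there —
the socket's `hRep_of_termwise` + `h238_of_hRep_half` ((2.38) on `U` with `A := C₃ε₁`, `R := (1−8δ)½Lκ`) and S25 `analytic_and_bounded_locE_param_torus` on `U`; `Gk.E` IS the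
one `locE` literal. [cite: Balaban1988RG2Cluster, (2.26) p.17, Lemma 3 (2.38) p.20 and (2.39)-(2.41) p.21] -/
theorem stepE_stripOn_of_termwise226 [NeZero M] {k' : ℕ} (Gk : StepGen (F.P k) 𝔸 M k') (c : B13.Consts) {L : ℕ} [NeZero L] (hL : 8 ≤ c.L)
    (hLc : c.L = L) {a a₂ a₂' a₅ Aabs : ℝ} (hN : Lemma3Numerics c M ((c.L : ℝ) / 2) a a₂ a₂' a₅ Aabs)
    {E₀ κ r₁ : ℝ} (hA0 : 0 ≤ c.C3act * c.ε₁) (hr₁ : 0 ≤ r₁) (hκ : κ ≤ r₁)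
    (hrate : r₁ + 2 * (64 * Real.log 162) + 2 ≤ (1 - 8 * c.δ) * ((c.L : ℝ) / 2) * c.κ)
    (hsmall : c.C3act * c.ε₁ * Real.exp (5 * r₁ + 1) * K₀ 64 8 * 9 * 64 ≤ 1)
    (hrenew : Real.exp 1 * 9 * 64 * K₀ 64 8 ^ 2 * (c.C3act * c.ε₁) ≤ E₀) (old : OlderTerms (F.P k) 𝔸 M k') (φ : CPair (F.P k) 𝔸)
    (X : (domSys (F.P k) M (k' + 1)).Dom)
    (Tt : (Z : TDom 4 (domCount (F.P k) M (k' + 1))) →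
      Finset (TDom 4 (L * domCount (F.P k) M (k' + 1))) × Finset (TBond 4 M (L * domCount (F.P k) M (k' + 1))) → ℂ → ℂ)
    (U : Set ℂ) (hU : IsOpen U)
    (hhol : ∀ Z : (domSys (F.P k) M (k' + 1)).Dom, Z.1 ⊆ X.1 → DifferentiableOn ℂ (fun z => Gk.H z old φ Z) U)
    (hdom : ∀ z ∈ U, ∀ Z : TDom 4 (domCount (F.P k) M (k' + 1)), Z.1 ⊆ X.1 → ‖Gk.H z old φ Z‖ ≤ ∑ t ∈ terms L M Z, ‖Tt Z t z‖)
    (h226 : ∀ z ∈ U, ∀ Z : TDom 4 (domCount (F.P k) M (k' + 1)), Z.1 ⊆ X.1 → ∀ t ∈ terms L M Z,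
      ‖Tt Z t z‖ ≤ weight L M c Z a t * Real.exp (a₅ * ((Z.1).card : ℝ))) :
    DifferentiableOn ℂ (fun z => Gk.E z old φ X) U ∧ ∀ z ∈ U, ‖Gk.E z old φ X‖ ≤ E₀ * Real.exp (-(κ * torusTreeLen X.1)) := by
  -- (2.26) per term in resummed-index form at the strip step on `U`
  have hrep : HRep c M a a₅
      ({ volk := fun _ => 0, Φ := ℂ, Bond := PUnit, sp1 := fun _ => ∅, sp2 := fun Z => {z | z ∈ U ∧ Z.1 ⊆ X.1},
         Bv := fun _ _ => 0, Vp := fun _ _ => 0, V := fun _ _ => 0, Q := fun _ _ _ _ => 0, Vpp := fun _ _ => 0,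
         H := fun Z z => Gk.H z old φ Z, Ek1 := fun _ _ => 0, Elog := fun _ _ => 0, Analytic := fun _ _ => True,
         GaugeInv := fun _ => True, Repr17 := True, Restr := True } : TwoTorusStep 4 L (domCount (F.P k) M (k' + 1))) :=
    hRep_of_termwise c (mul_nonneg hN.hα₆.le hN.hε₀) _ (fun Z t z => Tt Z t z) (fun Z z hz => hdom z hz.1 Z hz.2)
      (fun Z z hz t ht => h226 z hz.1 Z hz.2 t ht)
  have h238 := h238_of_hRep_half c hL hLc (N' := fun _ : ℕ => domCount (F.P k) M (k' + 1)) (fun _ => _) M hN (fun _ => hrep) 0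
  -- S25 on `U`
  have key := analytic_and_bounded_locE_param_torus (N := domCount (F.P k) M (k' + 1)) (P := ℂ)
    (m := fun Z : (tsys 4 (domCount (F.P k) M (k' + 1))).Dom => c.C3act * c.ε₁ * Real.exp (-((1 - 8 * c.δ) * ((c.L : ℝ) / 2) * c.κ * torusTreeLen Z.1)))
    (act := fun z Z => Gk.H z old φ Z) (A := c.C3act * c.ε₁) (R := (1 - 8 * c.δ) * ((c.L : ℝ) / 2) * c.κ) (r₁ := r₁) X hU hA0 hr₁ hrate hsmall hhol
    (fun z hz Z hZ => h238 Z z ⟨hz, hZ⟩) (fun Z _ => le_rfl)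
  have hM : 0 ≤ Real.exp 1 * 9 * 64 * K₀ 64 8 ^ 2 * (c.C3act * c.ε₁) := by positivity
  have hE : ∀ z, Gk.E z old φ X = locE (TTouch (d := 4) (N := domCount (F.P k) M (k' + 1)))
      (fun Z : (tsys 4 (domCount (F.P k) M (k' + 1))).Dom => Z.1) (fun Z => Gk.H z old φ Z) X.1 := fun z => rfl
  refine ⟨(key.1).congr fun z _ => hE z, fun z hz => ?_⟩
  rw [hE z]
  calc ‖locE (TTouch (d := 4) (N := domCount (F.P k) M (k' + 1))) (fun Z : (tsys 4 (domCount (F.P k) M (k' + 1))).Dom => Z.1)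
          (fun Z => Gk.H z old φ Z) X.1‖
      ≤ Real.exp 1 * 9 * 64 * K₀ 64 8 ^ 2 * (c.C3act * c.ε₁) * Real.exp (-(r₁ * torusTreeLen X.1)) := key.2 z hz
    _ ≤ E₀ * Real.exp (-(κ * torusTreeLen X.1)) :=
        mul_le_mul hrenew (Real.exp_le_exp.2 (neg_le_neg (mul_le_mul_of_nonneg_right hκ (torusTreeLen_nonneg _))))
          (Real.exp_nonneg _) (le_trans hM hrenew)

/-! ## §2 (S-last) from the term-level last-coupling schema (S-last-T) -/

open Classical in
/-- **(S-last) FROM THE TERM-LEVEL SCHEMA (S-last-T)** at the steps `k′ < K` of a generator tower `Gn`: (S-last-T)_{k′} — for every older-terms family `old` there is an open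
`U ⊇` the closed `r`-discs about `]0, γ]` such that IF `old` is (1.18)-bounded on the space tables THEN for every `X`, `φ ∈ U^c_{k′+1}(X)` there are complexified term values
`Tt` over print's `terms L M Z` with `z ↦ (Gn k′).H z old φ Z` holomorphic on `U` (`Z ⊆ X`), dominated by `Σ_t ‖Tt‖`, each `‖Tt Z t z‖ ≤ weight(t)·e^{a₅|Z|}` — with the socket
numerals, S25's clauses and the renewal ⟹ 18′'s (S-last)_{k′<K} (§1 per step). [cite: Balaban1988RG2Cluster, (2.26) p.17 and Lemma 3 p.20; Balaban1987RG1, §1 p.263] -/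
theorem stepSchemaLast_of_termwise [NeZero M] (Gn : GenTower (F.P k) 𝔸 M) (K : ℕ) (c : B13.Consts) {L : ℕ} [NeZero L] (hL : 8 ≤ c.L)
    (hLc : c.L = L) {a a₂ a₂' a₅ Aabs : ℝ} (hN : Lemma3Numerics c M ((c.L : ℝ) / 2) a a₂ a₂' a₅ Aabs)
    {cs : SFConsts} {γ r E₀ κ r₁ : ℝ} (hA0 : 0 ≤ c.C3act * c.ε₁) (hr₁ : 0 ≤ r₁) (hκ : κ ≤ r₁)
    (hrate : r₁ + 2 * (64 * Real.log 162) + 2 ≤ (1 - 8 * c.δ) * ((c.L : ℝ) / 2) * c.κ)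
    (hsmall : c.C3act * c.ε₁ * Real.exp (5 * r₁ + 1) * K₀ 64 8 * 9 * 64 ≤ 1)
    (hrenew : Real.exp 1 * 9 * 64 * K₀ 64 8 ^ 2 * (c.C3act * c.ε₁) ≤ E₀)
    (hlastT : ∀ (k' : ℕ), k' < K → ∀ (old : OlderTerms (F.P k) 𝔸 M k'), ∃ U : Set ℂ, IsOpen U ∧ (∀ t ∈ Ioc (0 : ℝ) γ, closedBall (t : ℂ) r ⊆ U) ∧
      ((∀ (j : Fin (k' + 1)) (Y : (domSys (F.P k) M j).Dom) (ψ : CPair (F.P k) 𝔸), ψ ∈ spaceI Sg Rz M j (domSites (F.P k) M j Y) cs.α₀ cs.α₁ →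
          ‖old j Y ψ‖ ≤ E₀ * Real.exp (-(κ * torusTreeLen Y.1))) →
        ∀ (X : (domSys (F.P k) M (k' + 1)).Dom) (φ : CPair (F.P k) 𝔸), φ ∈ spaceI Sg Rz M (k' + 1) (domSites (F.P k) M (k' + 1) X) cs.α₀ cs.α₁ →
          ∃ Tt : (Z : TDom 4 (domCount (F.P k) M (k' + 1))) →
              Finset (TDom 4 (L * domCount (F.P k) M (k' + 1))) × Finset (TBond 4 M (L * domCount (F.P k) M (k' + 1))) → ℂ → ℂ,
            (∀ Z : (domSys (F.P k) M (k' + 1)).Dom, Z.1 ⊆ X.1 → DifferentiableOn ℂ (fun z => (Gn k').H z old φ Z) U) ∧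
            (∀ z ∈ U, ∀ Z : TDom 4 (domCount (F.P k) M (k' + 1)), Z.1 ⊆ X.1 → ‖(Gn k').H z old φ Z‖ ≤ ∑ t ∈ terms L M Z, ‖Tt Z t z‖) ∧
            (∀ z ∈ U, ∀ Z : TDom 4 (domCount (F.P k) M (k' + 1)), Z.1 ⊆ X.1 → ∀ t ∈ terms L M Z,
              ‖Tt Z t z‖ ≤ weight L M c Z a t * Real.exp (a₅ * ((Z.1).card : ℝ))))) :
    ∀ (k' : ℕ), k' < K → ∀ (old : OlderTerms (F.P k) 𝔸 M k'), ∃ U : Set ℂ, IsOpen U ∧ (∀ t ∈ Ioc (0 : ℝ) γ, closedBall (t : ℂ) r ⊆ U) ∧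
      ((∀ (j : Fin (k' + 1)) (Y : (domSys (F.P k) M j).Dom) (ψ : CPair (F.P k) 𝔸), ψ ∈ spaceI Sg Rz M j (domSites (F.P k) M j Y) cs.α₀ cs.α₁ →
          ‖old j Y ψ‖ ≤ E₀ * Real.exp (-(κ * torusTreeLen Y.1))) →
        ∀ (X : (domSys (F.P k) M (k' + 1)).Dom) (φ : CPair (F.P k) 𝔸), φ ∈ spaceI Sg Rz M (k' + 1) (domSites (F.P k) M (k' + 1) X) cs.α₀ cs.α₁ →
          DifferentiableOn ℂ (fun z => (Gn k').E z old φ X) U ∧ ∀ z ∈ U, ‖(Gn k').E z old φ X‖ ≤ E₀ * Real.exp (-(κ * torusTreeLen X.1))) := by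
  intro k' hk old
  obtain ⟨U, hU, hdisc, hcond⟩ := hlastT k' hk old
  refine ⟨U, hU, hdisc, fun hadm X φ hφ => ?_⟩
  obtain ⟨Tt, hhol, hdom, h226⟩ := hcond hadm X φ hφ
  exact stepE_stripOn_of_termwise226 k (Gn k') c hL hLc hN hA0 hr₁ hκ hrate hsmall hrenew old φ X Tt U hU hhol hdom h226

open Classical in
/-- **(S-last) FROM THE PER-TERM LAST-COUPLING SCHEMA UNDER INDEX MAPS INTO PRINT's TERM SET** (module 20′ §1's re-indexing, now in the last-coupling direction): per step
`k′ < K`, index maps `e k′ Z : Idx → terms` (into `terms L M Z`, injective on `idx Z`), and «∀ old, ∃ U ⊇ closed r-discs, ((1.18)-size of `old` → ∀ X φ, Z ⊆ X, i ∈ idx Z: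
`z ↦ (Gn k′).T i z old φ` holomorphic on `U` with `‖·‖ ≤ weight(e Z i)·e^{a₅|Z|}`)» ⟹ (S-last)_{k′<K}. [cite: Balaban1988RG2Cluster, (2.9)-(2.14) pp.14-15 and (2.26) p.17] -/
theorem stepSchemaLast_of_termwiseIdx [NeZero M] (Gn : GenTower (F.P k) 𝔸 M) (K : ℕ) (c : B13.Consts) {L : ℕ} [NeZero L] (hL : 8 ≤ c.L)
    (hLc : c.L = L) {a a₂ a₂' a₅ Aabs : ℝ} (hN : Lemma3Numerics c M ((c.L : ℝ) / 2) a a₂ a₂' a₅ Aabs)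
    {cs : SFConsts} {γ r E₀ κ r₁ : ℝ} (hA0 : 0 ≤ c.C3act * c.ε₁) (hr₁ : 0 ≤ r₁) (hκ : κ ≤ r₁)
    (hrate : r₁ + 2 * (64 * Real.log 162) + 2 ≤ (1 - 8 * c.δ) * ((c.L : ℝ) / 2) * c.κ)
    (hsmall : c.C3act * c.ε₁ * Real.exp (5 * r₁ + 1) * K₀ 64 8 * 9 * 64 ≤ 1)
    (hrenew : Real.exp 1 * 9 * 64 * K₀ 64 8 ^ 2 * (c.C3act * c.ε₁) ≤ E₀)
    (e : (k' : ℕ) → (Z : (domSys (F.P k) M (k' + 1)).Dom) → (Gn k').Idx →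
      Finset (TDom 4 (L * domCount (F.P k) M (k' + 1))) × Finset (TBond 4 M (L * domCount (F.P k) M (k' + 1))))
    (he : ∀ (k' : ℕ), k' < K → ∀ (Z : (domSys (F.P k) M (k' + 1)).Dom), ∀ i ∈ (Gn k').idx Z, e k' Z i ∈ terms L M Z)
    (hinj : ∀ (k' : ℕ), k' < K → ∀ (Z : (domSys (F.P k) M (k' + 1)).Dom), Set.InjOn (e k' Z) ((Gn k').idx Z))
    (hlastTi : ∀ (k' : ℕ), k' < K → ∀ (old : OlderTerms (F.P k) 𝔸 M k'), ∃ U : Set ℂ, IsOpen U ∧ (∀ t ∈ Ioc (0 : ℝ) γ, closedBall (t : ℂ) r ⊆ U) ∧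
      ((∀ (j : Fin (k' + 1)) (Y : (domSys (F.P k) M j).Dom) (ψ : CPair (F.P k) 𝔸), ψ ∈ spaceI Sg Rz M j (domSites (F.P k) M j Y) cs.α₀ cs.α₁ →
          ‖old j Y ψ‖ ≤ E₀ * Real.exp (-(κ * torusTreeLen Y.1))) →
        ∀ (X : (domSys (F.P k) M (k' + 1)).Dom) (φ : CPair (F.P k) 𝔸), φ ∈ spaceI Sg Rz M (k' + 1) (domSites (F.P k) M (k' + 1) X) cs.α₀ cs.α₁ →
          ∀ (Z : (domSys (F.P k) M (k' + 1)).Dom), Z.1 ⊆ X.1 → ∀ i ∈ (Gn k').idx Z,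
            DifferentiableOn ℂ (fun z => (Gn k').T i z old φ) U ∧
            ∀ z ∈ U, ‖(Gn k').T i z old φ‖ ≤ weight L M c Z a (e k' Z i) * Real.exp (a₅ * ((Z.1).card : ℝ)))) :
    ∀ (k' : ℕ), k' < K → ∀ (old : OlderTerms (F.P k) 𝔸 M k'), ∃ U : Set ℂ, IsOpen U ∧ (∀ t ∈ Ioc (0 : ℝ) γ, closedBall (t : ℂ) r ⊆ U) ∧
      ((∀ (j : Fin (k' + 1)) (Y : (domSys (F.P k) M j).Dom) (ψ : CPair (F.P k) 𝔸), ψ ∈ spaceI Sg Rz M j (domSites (F.P k) M j Y) cs.α₀ cs.α₁ →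
          ‖old j Y ψ‖ ≤ E₀ * Real.exp (-(κ * torusTreeLen Y.1))) →
        ∀ (X : (domSys (F.P k) M (k' + 1)).Dom) (φ : CPair (F.P k) 𝔸), φ ∈ spaceI Sg Rz M (k' + 1) (domSites (F.P k) M (k' + 1) X) cs.α₀ cs.α₁ →
          DifferentiableOn ℂ (fun z => (Gn k').E z old φ X) U ∧ ∀ z ∈ U, ‖(Gn k').E z old φ X‖ ≤ E₀ * Real.exp (-(κ * torusTreeLen X.1))) := by
  refine stepSchemaLast_of_termwise k Sg Rz Gn K c hL hLc hN hA0 hr₁ hκ hrate hsmall hrenew fun k' hk old => ?_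
  obtain ⟨U, hU, hdisc, hcond⟩ := hlastTi k' hk old
  refine ⟨U, hU, hdisc, fun hadm X φ hφ => ?_⟩
  have hT := hcond hadm X φ hφ
  have hA6 : 0 ≤ c.α₆ * c.eps2 := mul_nonneg hN.hα₆.le hN.hε₀
  refine ⟨fun Z t z => ∑ i ∈ ((Gn k').idx Z).filter (fun i => e k' Z i = t), (Gn k').T i z old φ, fun Z hZ => ?_, fun z hz Z hZ => ?_,
    fun z hz Z hZ t ht => ?_⟩
  · show DifferentiableOn ℂ (fun z => ∑ i ∈ (Gn k').idx Z, (Gn k').T i z old φ) U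
    exact DifferentiableOn.fun_sum fun i hi => (hT Z hZ i hi).1
  · have hsplit : (Gn k').H z old φ Z = ∑ t ∈ terms L M Z, ∑ i ∈ ((Gn k').idx Z).filter (fun i => e k' Z i = t), (Gn k').T i z old φ := by
      unfold StepGen.H
      exact (Finset.sum_fiberwise_of_maps_to (he k' hk Z) _).symm
    rw [hsplit]
    exact norm_sum_le _ _
  · have hcard : (((Gn k').idx Z).filter (fun i => e k' Z i = t)).card ≤ 1 :=
      Finset.card_le_one.2 fun i₁ h₁ i₂ h₂ =>
        hinj k' hk Z (Finset.mem_filter.1 h₁).1 (Finset.mem_filter.1 h₂).1 ((Finset.mem_filter.1 h₁).2.trans (Finset.mem_filter.1 h₂).2.symm)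
    have hw : 0 ≤ weight L M c Z a t * Real.exp (a₅ * ((Z.1).card : ℝ)) := mul_nonneg (weight_nonneg c Z a hA6 t) (Real.exp_pos _).le
    calc ‖∑ i ∈ ((Gn k').idx Z).filter (fun i => e k' Z i = t), (Gn k').T i z old φ‖
        ≤ ∑ i ∈ ((Gn k').idx Z).filter (fun i => e k' Z i = t), ‖(Gn k').T i z old φ‖ := norm_sum_le _ _
      _ ≤ ∑ i ∈ ((Gn k').idx Z).filter (fun i => e k' Z i = t), weight L M c Z a t * Real.exp (a₅ * ((Z.1).card : ℝ)) := by
          refine Finset.sum_le_sum fun i hi => ?_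
          obtain ⟨hi', hit⟩ := Finset.mem_filter.1 hi
          rw [← hit]
          exact (hT Z hZ i hi').2 z hz
      _ = (((Gn k').idx Z).filter (fun i => e k' Z i = t)).card * (weight L M c Z a t * Real.exp (a₅ * ((Z.1).card : ℝ))) := by
          rw [Finset.sum_const, nsmul_eq_mul]
      _ ≤ 1 * (weight L M c Z a t * Real.exp (a₅ * ((Z.1).card : ℝ))) := mul_le_mul_of_nonneg_right (by exact_mod_cast hcard) hw
      _ = weight L M c Z a t * Real.exp (a₅ * ((Z.1).card : ℝ)) := one_mul _

end StepLevel

/-! ## §3 The N22 leaf with ALL analytic inputs at term level -/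

section AllTermwiseEdge

variable (Gn : (F : T4Family) → (θ : Stage12Params F N) → (k : ℕ) → GenTower (F.P k) (MatA N) θ.τ9.M)
  (sp : (F : T4Family) → (θ : Stage12Params F N) → (k j : ℕ) → (domSys (F.P k) θ.τ9.M j).Dom → Set (CPair (F.P k) (MatA N)))
  (gauge : (F : T4Family) → (θ : Stage12Params F N) → (k : ℕ) → GaugeField (F.P k) 0 (Node00.SU N) → GaugeField (F.P k) 0 (Node00.SU N) → ℝ)
  (hg : ∀ (F : T4Family) (θ : Stage12Params F N) (k : ℕ) (U U' : GaugeField (F.P k) 0 (Node00.SU N)), 0 ≤ gauge F θ k U U')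
  (T₀ : (F : T4Family) → (θ : Stage12Params F N) → (k : ℕ) → GaugeField (F.P (k + 1)) 0 (Node00.SU N) → GaugeField (F.P k) 0 (Node00.SU N))
  (hT : ∀ (F : T4Family) (θ : Stage12Params F N) (k : ℕ) (U : GaugeField (F.P (k + 1)) 0 (Node00.SU N)),
    (∀ (j : ℕ) (Y : (domSys (F.P (k + 1)) θ.τ9.M j).Dom), ofBackgroundC (ιSU N) U ∈ sp F θ (k + 1) j Y) →
      ∀ (j : ℕ) (X : (domSys (F.P k) θ.τ9.M j).Dom), ofBackgroundC (ιSU N) (T₀ F θ k U) ∈ sp F θ k j X)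
  (li : (F : T4Family) → Stage12Params F N → LetterInputs) (ℓ₃ : T4Family → Node00.NE3Letters₁₁)
  (ne2 : (F : T4Family) → Stage12Params F N → (ℕ → ℝ) → List (ULoop F) → ℕ → Node00.NE2Objects₁₁)
  (ne1 : (F : T4Family) → Stage12Params F N → (ℕ → ℝ) → List (ULoop F) → NE1pCarriers) {G : Type*} [GaugeGroup G]

open Classical in
/-- **THE EDGE N18 → N22 AT THE ADMISSIBLE READING OF RECORD ON THE GENERATED TOWERS OF THE RUNS OF RECORD — ALL ANALYTIC INPUTS AT TERM LEVEL** (20′ §3 with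
(S-last) replaced by the per-term last-coupling schema under the same index maps; §2 supplies (S-last), 20′ §1 supplies (S-226)): `S_N18 (RRec₁₂ 𝔯)` + the letter signs + per
`(F, θ, k)` ∃(`NeZero θ.τ9.M`, `Sg`, `Rz`, `cs`, `c`, `L`, `NeZero L`, `a a₂ a₂′ a₅ Aabs r₁`, index maps `e`; `hspk`; numerals; (S-loc)_{k′<k}; `e` into `terms` + injective;
(S-226-T)_{k′<k} — [II] (2.26) per term with COMPLEX OLDER TERMS, node N10; (S-last-T)_{k′<k} — [II] (2.26) per term with COMPLEX LAST COUPLING given (1.18)-size of the real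
older terms, node N09) ⟹ `S_N22 (RRec₁₂ 𝔯)`. [cite: Balaban1988RG2Cluster, (2.9)-(2.15) pp.14-15, (2.26) p.17, Lemma 3 p.20 and (2.39)-(2.41) p.21; Balaban1987RG1, §1 p.263 and (2.12)-(2.13) p.268] -/
theorem s_N22_readingOfRecord₁₂_ofRecordAdm_runTowers_toClusterTower_of_s_N18_allTermwise
    (h18 : S_N18 (RRec₁₂ (readingOfRecord₁₂
      (fun F θ => ReadingData.ofRecordAdm F θ.τ9.M N (runTowers fun k => toClusterTower (Gn F θ k)) (sp F θ) (gauge F θ) (hg F θ) (T₀ F θ) (hT F θ)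
        (li F θ)) ℓ₃ ne2 ne1)))
    (hnum : ∀ (F : T4Family) (θ : Stage12Params F N), θ.Provisos₁₂ F N → θ.Admissible F N →
      0 < (li F θ).C₀ ∧ 0 < (li F θ).θ₅ ∧ (li F θ).θ₅ < 1 ∧ 0 ≤ (li F θ).C₅ ∧ 2 * (li F θ).C₅ / (1 - (li F θ).θ₅) ≤ (li F θ).C₀ ∧ 0 < (li F θ).A ∧
        (li F θ).θ₅ ≤ (li F θ).μ ∧ (li F θ).C₀ ≤ 2 * (li F θ).A ∧ 0 < (li F θ).r ∧ 0 < (li F θ).s ∧ (li F θ).s < 1 ∧ 1 ≤ (li F θ).μ)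
    (hdata : ∀ (F : T4Family) (θ : Stage12Params F N), θ.Provisos₁₂ F N → θ.Admissible F N → ∀ (k : ℕ),
      ∃ (_ : NeZero θ.τ9.M) (Sg : Setting (MatA N) G) (Rz : Residual (F.P k) (MatA N))
        (cs : SFConsts) (c : B13.Consts) (L : ℕ) (_ : NeZero L) (a a₂ a₂' a₅ Aabs r₁ : ℝ)
        (e : (k' : ℕ) → (Z : (domSys (F.P k) θ.τ9.M (k' + 1)).Dom) → (Gn F θ k k').Idx →
          Finset (TDom 4 (L * domCount (F.P k) θ.τ9.M (k' + 1))) × Finset (TBond 4 θ.τ9.M (L * domCount (F.P k) θ.τ9.M (k' + 1)))),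
        (∀ (j : ℕ) (Y : (domSys (F.P k) θ.τ9.M j).Dom), sp F θ k j Y ⊆ spaceI Sg Rz θ.τ9.M j (domSites (F.P k) θ.τ9.M j Y) cs.α₀ cs.α₁) ∧
        8 ≤ c.L ∧ c.L = L ∧ Lemma3Numerics c θ.τ9.M ((c.L : ℝ) / 2) a a₂ a₂' a₅ Aabs ∧ 0 ≤ c.C3act * c.ε₁ ∧ 0 ≤ r₁ ∧ (li F θ).κ ≤ r₁ ∧
        r₁ + 2 * (64 * Real.log 162) + 2 ≤ (1 - 8 * c.δ) * ((c.L : ℝ) / 2) * c.κ ∧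
        c.C3act * c.ε₁ * Real.exp (5 * r₁ + 1) * K₀ 64 8 * 9 * 64 ≤ 1 ∧
        Real.exp 1 * 9 * 64 * K₀ 64 8 ^ 2 * (c.C3act * c.ε₁) ≤ (li F θ).A ∧
        (∀ (k' : ℕ), k' < k → ∀ (t : ℂ) (old old' : OlderTerms (F.P k) (MatA N) θ.τ9.M k') (φ : CPair (F.P k) (MatA N))
          (Z : (domSys (F.P k) θ.τ9.M (k' + 1)).Dom),
          (∀ (j : Fin (k' + 1)) (Y : (domSys (F.P k) θ.τ9.M j).Dom) (ψ : CPair (F.P k) (MatA N)),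
            ψ ∈ spaceI Sg Rz θ.τ9.M j (domSites (F.P k) θ.τ9.M j Y) cs.α₀ cs.α₁ → old j Y ψ = old' j Y ψ) →
          (Gn F θ k k').H t old φ Z = (Gn F θ k k').H t old' φ Z) ∧
        (∀ (k' : ℕ), k' < k → ∀ (Z : (domSys (F.P k) θ.τ9.M (k' + 1)).Dom), ∀ i ∈ (Gn F θ k k').idx Z, e k' Z i ∈ terms L θ.τ9.M Z) ∧
        (∀ (k' : ℕ), k' < k → ∀ (Z : (domSys (F.P k) θ.τ9.M (k' + 1)).Dom), Set.InjOn (e k' Z) ((Gn F θ k k').idx Z)) ∧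
        (∀ (k' : ℕ), k' < k → ∀ (D : Set ℂ), IsOpen D → (∀ t ∈ Ioc (0 : ℝ) θ.γ, closedBall (t : ℂ) (li F θ).r ⊆ D) →
          ∀ (s : ℝ), s ∈ Ioc (0 : ℝ) θ.γ → ∀ (cv : ℂ → OlderTerms (F.P k) (MatA N) θ.τ9.M k'),
          (∀ (j : Fin (k' + 1)) (Y : (domSys (F.P k) θ.τ9.M j).Dom) (ψ : CPair (F.P k) (MatA N)),
            ψ ∈ spaceI Sg Rz θ.τ9.M j (domSites (F.P k) θ.τ9.M j Y) cs.α₀ cs.α₁ →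
            DifferentiableOn ℂ (fun z => cv z j Y ψ) D ∧ ∀ z ∈ D, ‖cv z j Y ψ‖ ≤ (li F θ).A * Real.exp (-((li F θ).κ * torusTreeLen Y.1))) →
          ∀ (X : (domSys (F.P k) θ.τ9.M (k' + 1)).Dom) (φ : CPair (F.P k) (MatA N)),
          φ ∈ spaceI Sg Rz θ.τ9.M (k' + 1) (domSites (F.P k) θ.τ9.M (k' + 1) X) cs.α₀ cs.α₁ →
          ∀ (Z : (domSys (F.P k) θ.τ9.M (k' + 1)).Dom), Z.1 ⊆ X.1 → ∀ i ∈ (Gn F θ k k').idx Z,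
            DifferentiableOn ℂ (fun z => (Gn F θ k k').T i (s : ℂ) (cv z) φ) D ∧
            ∀ z ∈ D, ‖(Gn F θ k k').T i (s : ℂ) (cv z) φ‖ ≤ weight L θ.τ9.M c Z a (e k' Z i) * Real.exp (a₅ * ((Z.1).card : ℝ))) ∧
        (∀ (k' : ℕ), k' < k → ∀ (old : OlderTerms (F.P k) (MatA N) θ.τ9.M k'), ∃ U : Set ℂ, IsOpen U ∧
          (∀ t ∈ Ioc (0 : ℝ) θ.γ, closedBall (t : ℂ) (li F θ).r ⊆ U) ∧
          ((∀ (j : Fin (k' + 1)) (Y : (domSys (F.P k) θ.τ9.M j).Dom) (ψ : CPair (F.P k) (MatA N)),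
              ψ ∈ spaceI Sg Rz θ.τ9.M j (domSites (F.P k) θ.τ9.M j Y) cs.α₀ cs.α₁ → ‖old j Y ψ‖ ≤ (li F θ).A * Real.exp (-((li F θ).κ * torusTreeLen Y.1))) →
            ∀ (X : (domSys (F.P k) θ.τ9.M (k' + 1)).Dom) (φ : CPair (F.P k) (MatA N)),
            φ ∈ spaceI Sg Rz θ.τ9.M (k' + 1) (domSites (F.P k) θ.τ9.M (k' + 1) X) cs.α₀ cs.α₁ →
            ∀ (Z : (domSys (F.P k) θ.τ9.M (k' + 1)).Dom), Z.1 ⊆ X.1 → ∀ i ∈ (Gn F θ k k').idx Z,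
              DifferentiableOn ℂ (fun z => (Gn F θ k k').T i z old φ) U ∧
              ∀ z ∈ U, ‖(Gn F θ k k').T i z old φ‖ ≤ weight L θ.τ9.M c Z a (e k' Z i) * Real.exp (a₅ * ((Z.1).card : ℝ))))) :
    S_N22 (RRec₁₂ (readingOfRecord₁₂
      (fun F θ => ReadingData.ofRecordAdm F θ.τ9.M N (runTowers fun k => toClusterTower (Gn F θ k)) (sp F θ) (gauge F θ) (hg F θ) (T₀ F θ) (hT F θ)
        (li F θ)) ℓ₃ ne2 ne1)) := by
  refine s_N22_readingOfRecord₁₂_ofRecordAdm_runTowers_toClusterTower_of_s_N18_threeSchemas (G := G) Gn sp gauge hg T₀ hT li ℓ₃ ne2 ne1 h18 hnum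
    fun F θ hP hθ k => ?_
  obtain ⟨hMz, Sg, Rz, cs, c, L, hLz, a, a₂, a₂', a₅, Aabs, r₁, e, hspk, hL, hLc, hN, hA0, hr₁, hκ, hrate, hsmall, hrenew, hloc, he, hinj, h226T,
    hlastTi⟩ := hdata F θ hP hθ k
  exact ⟨hMz, Sg, Rz, cs, c, L, hLz, a, a₂, a₂', a₅, Aabs, r₁, hspk, hL, hLc, hN, hA0, hr₁, hκ, hrate, hsmall, hrenew, hloc,
    fun k' hk => stepSchema226_of_termwise k Sg Rz (Gn F θ k k') c (mul_nonneg hN.hα₆.le hN.hε₀) (e k') (he k' hk) (hinj k' hk) (h226T k' hk),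
    stepSchemaLast_of_termwiseIdx k Sg Rz (Gn F θ k) k c hL hLc hN hA0 hr₁ hκ hrate hsmall hrenew e he hinj hlastTi⟩

end AllTermwiseEdge


/-! ## §4 The admissible slot is inhabited at the space table of record (ref-F READ-173 rider (α), by name) -/

section Inhabited

variable {F : T4Family} {M : ℕ} (k : ℕ) {G : Type*} [GaugeGroup G] (Sg : Setting (MatA N) G) (Rz : Residual (F.P k) (MatA N))

/-- **THE ADMISSIBLE RUN-A SLOT IS INHABITED WHEN THE RUN-LENGTH-`k` TABLE IS THE SPACE TABLE OF RECORD** (the clause any COUNT claim at `ReadingData.ofRecordAdm` must carry,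
ref-F READ-173 (α) ∕ ref-H READ-50 A1 WATCH): under the residual laws, `0 < Sg.cB` and positive radii `cs.α₀, cs.α₁`, the UNIT gauge field reads inside every space
`U^c_j(Y, cs.α₀, cs.α₁)` (`Sect2.one_mem_spaceI`, `ofBackgroundC_one`), so `AdmBg F M N sp k` is non-empty (`AdmBg.nonempty_of_mem`) — and with it the universal run-A
quantification of `N22At` at this reading is not vacuous. [cite: Balaban1987RG1, (1.11)-(1.16) p.262] -/
theorem nonempty_admBg_of_spaceTable {sp : (k j : ℕ) → (domSys (F.P k) M j).Dom → Set (CPair (F.P k) (MatA N))} {cs : SFConsts}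
    (hspk : ∀ (j : ℕ) (Y : (domSys (F.P k) M j).Dom), sp k j Y = spaceI Sg Rz M j (domSites (F.P k) M j Y) cs.α₀ cs.α₁)
    (hc : 0 < Sg.cB) (hRz : Rz.Laws) (h₀ : 0 < cs.α₀) (h₁ : 0 < cs.α₁) : Nonempty (AdmBg F M N sp k) := by
  refine AdmBg.nonempty_of_mem F M N (1 : GaugeField (F.P k) 0 (Node00.SU N)) fun j Y => ?_
  rw [hspk j Y, Node00.Sect2.ofBackgroundC_one]
  have h := Node00.Sect2.one_mem_spaceI Sg hc hRz M j (domSites (F.P k) M j Y) h₀ h₁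
  rwa [Node00.Sect2.ofBackgroundC_one] at h

end Inhabited

end YMDAG.N22.W1

end
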